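import Mathlib.Analysis.InnerProductSpace.Calculus
import Mathlib.Analysis.Calculus.Deriv.MeanValue
import Mathlib.Analysis.SpecialFunctions.ExpDeriv
import Mathlib.MeasureTheory.Integral.IntervalIntegral.FundThmCalculus
import HarnessLib

/-!
# Forced linear systems with a uniformly dissipative generator: contraction, uniqueness and the
# `‖f‖/γ` bound for periodic solutions, free decay ("echo damping"), and the period-mean of an echo

Topic `Literature/Analysis/ODE` (namespace `Literature.Analysis.ODE.DissipativeResponse`). Everything here
is PROVED (no definition, no named fact).

THE SETTING. `E` is a real inner-product space, `A : ℝ → E →L[ℝ] E` a time-dependent generator which is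
UNIFORMLY DISSIPATIVE, `⟪A t x, x⟫ ≤ −γ‖x‖²` with `γ > 0` (logarithmic norm `μ₂(A(t)) ≤ −γ`,
Hairer–Nørsett–Wanner I §I.10 (10.20)), `f : ℝ → E` a forcing, and `x : ℝ → E` a solution of
`x' = A(t) x + f(t)` on an interval `[a,b]` in the weak bookkeeping "continuous on `[a,b]`, derivative
on `(a,b)`" (so that operator-valued periodic responses `N` instantiate through `t ↦ N t v`).

THE RESULTS (the classical consequences of the weighted energy identity
`(e^{κt}‖u‖²)' = e^{κt}(κ‖u‖² + 2⟪u, u'⟫)`):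
* `norm_sub_le_exp_neg_mul` — **contraction** of two solutions with the same forcing,
  `‖x t − y t‖ ≤ e^{−γ(t−a)}‖x a − y a‖` (HNW I Thm 10.6 with `δ = 0`); hence
  `eqOn_of_periodic` — **uniqueness** of the solution with `x b = x a` (Fink, Thm 7.7; Hale IV §1 Thm 1.1).
* `norm_le_div_of_periodic` — **the `‖f‖/γ` bound**: a solution with `x b = x a` (`a < b`) and
  `‖f‖ ≤ F` on `(a,b)` satisfies `‖x t‖ ≤ F/γ` on `[a,b]` (Fink Thm 7.7, stable case `K₁ = 1`, `σ₁ = γ`);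
  `norm_le_div_of_norm_le_div` — the absorbing-ball (forward) version.
* `norm_le_exp_neg_mul_of_forcing_eq_zero` — **free decay / echo damping**: if `f = 0` on `(s,t)` then
  `‖x t‖ ≤ e^{−γ(t−s)}‖x s‖`; with the previous item, `norm_le_exp_neg_mul_div_of_periodic`:
  `‖x t‖ ≤ e^{−γ(t−s)}·F/γ` for the periodic solution.
* `norm_intervalIntegral_le_of_echo` — **period-mean of an echo**: if `‖g τ‖ ≤ K‖x τ‖` and
  `‖x τ‖ ≤ B e^{−γ(τ−s)}` on `[t₁,t₂]` then `‖∫_{t₁}^{t₂} g‖ ≤ K B e^{−γ(t₁−s)}/γ`.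

These are the generic estimates behind the "memory/echo" bookkeeping of periodic linear responses
(e.g. the sideband response of a lattice cell problem driven slot by slot: the response to the forcing
of a foreign slot is damped by `e^{−γ·gap}` by the time it is read).

## Mathlib / tree search

Mathlib: Gronwall (`Mathlib.Analysis.ODE.Gronwall`: Lipschitz form, no one-sided/dissipative form),
`HasDerivAt.norm_sq`, `antitoneOn_of_hasDerivWithinAt_nonpos`; no logarithmic-norm estimate. Tree:
`ODE.norm_sq_le_of_dissipative` (`PeriodicDissipative`, nonlinear absorbing ball — the template of the
energy argument here), `PeriodicAveraging.norm_exp_neg_smul_apply_le` (constant coercive generator),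
`Floquet.exists_forced_add_period_iff` (Fredholm alternative, Hale IV Lemma 1.1), `Floquet.propagator`.

## References

* A. M. Fink, *Almost Periodic Differential Equations*, Lecture Notes in Math. 377, Springer (1974),
  Def. 7.1 (exponential dichotomy) and Thm 7.7 with its proof (held:
  `book:fink1974-almost-periodic-differential-equations`, PDF pp. 110, 112). [`Fink1974`]
* E. Hairer, S. P. Nørsett, G. Wanner, *Solving Ordinary Differential Equations I*, 2nd ed., Springer
  (1993), §I.10 Def. 10.4, Thm 10.5 (10.20), Thm 10.6 (10.22) (held:
  `book:hairer1993-solving-ordinary-differential-equations-i`, PDF pp. 52–53). [`HairerNorsettWanner1993`]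
* J. K. Hale, *Ordinary Differential Equations*, 2nd ed., Krieger (1980), Ch. IV §1, Lemma 1.1 and
  Thm 1.1 with (1.9), (1.13) (held: `book:halend-ordinary-differential-equations`, PDF pp. 144–148). [`Hale1980`]
-/

noncomputable section

open Set Filter MeasureTheory intervalIntegral
open scoped InnerProductSpace Topology

namespace Literature.Analysis.ODE

namespace DissipativeResponse

variable {E : Type*} [NormedAddCommGroup E] [InnerProductSpace ℝ E]

/-! ## The weighted energy argument -/

/-- **Weighted energy monotonicity.** If `u` is continuous on `[a,b]`, differentiable on `(a,b)` with
`2⟪u, u'⟫ ≤ −κ‖u‖² + c` (`κ ≠ 0`), then `t ↦ e^{κt}(‖u t‖² − c/κ)` is non-increasing on `[a,b]`.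
[cite: HairerNorsettWanner1993, §I.10 Thm 10.6 (proof: Dini derivative of the weighted norm)] -/
theorem antitoneOn_exp_mul_norm_sq_sub {u u' : ℝ → E} {a b κ c : ℝ} (hκ : κ ≠ 0)
    (hu : ContinuousOn u (Icc a b)) (hd : ∀ t ∈ Ioo a b, HasDerivAt u (u' t) t)
    (hle : ∀ t ∈ Ioo a b, 2 * ⟪u t, u' t⟫_ℝ ≤ -κ * ‖u t‖ ^ 2 + c) :
    AntitoneOn (fun s => Real.exp (κ * s) * (‖u s‖ ^ 2 - c / κ)) (Icc a b) := by
  have hcont : ContinuousOn (fun s => Real.exp (κ * s) * (‖u s‖ ^ 2 - c / κ)) (Icc a b) :=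
    (Real.continuous_exp.comp (continuous_const.mul continuous_id)).continuousOn.mul
      ((hu.norm.pow 2).sub continuousOn_const)
  refine antitoneOn_of_hasDerivWithinAt_nonpos (convex_Icc a b) hcont
    (f' := fun s => κ * Real.exp (κ * s) * (‖u s‖ ^ 2 - c / κ) +
      Real.exp (κ * s) * (2 * ⟪u s, u' s⟫_ℝ)) ?_ ?_
  · intro s hs
    rw [interior_Icc] at hs
    have h1 : HasDerivAt (fun s => Real.exp (κ * s)) (κ * Real.exp (κ * s)) s := by
      have h := ((hasDerivAt_id s).const_mul κ).exp
      exact h.congr_deriv (by simp only [id_eq, mul_one]; ring)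
    have h2 : HasDerivAt (fun s => ‖u s‖ ^ 2 - c / κ) (2 * ⟪u s, u' s⟫_ℝ) s :=
      (hd s hs).norm_sq.sub_const _
    exact (h1.mul h2).hasDerivWithinAt
  · intro s hs
    rw [interior_Icc] at hs
    have h := hle s hs
    have hcκ : κ * (c / κ) = c := mul_div_cancel₀ c hκ
    have h3 : κ * (‖u s‖ ^ 2 - c / κ) + 2 * ⟪u s, u' s⟫_ℝ ≤ 0 := by nlinarith [h, hcκ]
    have h4 : κ * Real.exp (κ * s) * (‖u s‖ ^ 2 - c / κ) + Real.exp (κ * s) * (2 * ⟪u s, u' s⟫_ℝ) =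
        Real.exp (κ * s) * (κ * (‖u s‖ ^ 2 - c / κ) + 2 * ⟪u s, u' s⟫_ℝ) := by ring
    rw [h4]
    exact mul_nonpos_iff.2 (Or.inl ⟨(Real.exp_pos _).le, h3⟩)

omit [InnerProductSpace ℝ E] in
/-- From the weighted comparison `e^{2γt}‖p‖² ≤ e^{2γa}‖q‖²` to `‖p‖ ≤ e^{−γ(t−a)}‖q‖`. [folklore] -/
private theorem norm_le_exp_neg_mul_of_weighted {γ t a : ℝ} {p q : E}
    (h : Real.exp (2 * γ * t) * ‖p‖ ^ 2 ≤ Real.exp (2 * γ * a) * ‖q‖ ^ 2) :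
    ‖p‖ ≤ Real.exp (-γ * (t - a)) * ‖q‖ := by
  have hM : 0 ≤ Real.exp (-γ * (t - a)) * ‖q‖ := by positivity
  refine (pow_le_pow_iff_left₀ (norm_nonneg _) hM two_ne_zero).1 ?_
  have e1 : (Real.exp (-γ * (t - a)) * ‖q‖) ^ 2 = Real.exp (2 * γ * a - 2 * γ * t) * ‖q‖ ^ 2 := by
    rw [mul_pow, pow_two (Real.exp _), ← Real.exp_add]
    congr 2
    ring
  rw [e1, Real.exp_sub, div_mul_eq_mul_div, le_div_iff₀ (Real.exp_pos _), mul_comm]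
  exact h

/-! ## Contraction and uniqueness -/

section Dissipative

variable {A : ℝ → E →L[ℝ] E} {γ : ℝ}

/-- **Contraction of two solutions with the same forcing** under uniform dissipativity
`⟪A t x, x⟫ ≤ −γ‖x‖²`: `‖x t − y t‖ ≤ e^{−γ(t−a)}‖x a − y a‖` on `[a,b]` (the difference solves the
homogeneous equation; weighted energy). [cite: HairerNorsettWanner1993, §I.10 Thm 10.6 (10.22) with δ = 0, ℓ = −γ] -/
theorem norm_sub_le_exp_neg_mul (hA : ∀ t x, ⟪A t x, x⟫_ℝ ≤ -γ * ‖x‖ ^ 2) {f x y : ℝ → E} {a b : ℝ}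
    (hxc : ContinuousOn x (Icc a b)) (hx : ∀ t ∈ Ioo a b, HasDerivAt x (A t (x t) + f t) t)
    (hyc : ContinuousOn y (Icc a b)) (hy : ∀ t ∈ Ioo a b, HasDerivAt y (A t (y t) + f t) t)
    {t : ℝ} (ht : t ∈ Icc a b) : ‖x t - y t‖ ≤ Real.exp (-γ * (t - a)) * ‖x a - y a‖ := by
  by_cases hγ0 : γ = 0
  · subst hγ0
    -- trivial weight: still a contraction with factor 1? only `γ = 0` gives factor `e^0 = 1`; prove via κ-argument with κ := 0? use κ-free bound
    -- with γ = 0 the dissipativity says ⟪A x, x⟫ ≤ 0; run the argument with a tiny shift is not possible, so do it directly with κ = 1? No: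
    -- instead apply the weighted lemma with κ := 2 * 1 to u scaled? Simplest: the claim for γ = 0 follows from the claim for every γ' < 0? Not available.
    -- We give the direct energy argument with weight 1 (κ → 0 limit) via `antitoneOn` of ‖u‖².
    have hd : ∀ s ∈ Ioo a b, HasDerivAt (fun s => x s - y s) (A s (x s - y s)) s := fun s hs =>
      ((hx s hs).sub (hy s hs)).congr_deriv (by rw [map_sub]; abel)
    have hanti : AntitoneOn (fun s => ‖x s - y s‖ ^ 2) (Icc a b) := by
      have hcont : ContinuousOn (fun s => ‖x s - y s‖ ^ 2) (Icc a b) := (hxc.sub hyc).norm.pow 2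
      refine antitoneOn_of_hasDerivWithinAt_nonpos (convex_Icc a b) hcont
        (f' := fun s => 2 * ⟪x s - y s, A s (x s - y s)⟫_ℝ) ?_ ?_
      · intro s hs
        rw [interior_Icc] at hs
        exact (hd s hs).norm_sq.hasDerivWithinAt
      · intro s hs
        have h := hA s (x s - y s)
        rw [real_inner_comm] at h
        nlinarith [h, sq_nonneg ‖x s - y s‖]
    have h2 : ‖x t - y t‖ ^ 2 ≤ ‖x a - y a‖ ^ 2 := hanti (left_mem_Icc.2 (ht.1.trans ht.2)) ht ht.1
    have h3 := (pow_le_pow_iff_left₀ (norm_nonneg _) (norm_nonneg _) two_ne_zero).1 h2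
    simpa using h3
  have hd : ∀ s ∈ Ioo a b, HasDerivAt (fun s => x s - y s) (A s (x s - y s)) s := fun s hs =>
    ((hx s hs).sub (hy s hs)).congr_deriv (by rw [map_sub]; abel)
  have hle : ∀ s ∈ Ioo a b, 2 * ⟪x s - y s, A s (x s - y s)⟫_ℝ ≤ -(2 * γ) * ‖x s - y s‖ ^ 2 + 0 := by
    intro s _
    have h := hA s (x s - y s)
    rw [real_inner_comm] at h
    linarith
  have hκ : (2 * γ) ≠ 0 := mul_ne_zero two_ne_zero hγ0
  have hanti := antitoneOn_exp_mul_norm_sq_sub hκ (hxc.sub hyc) hd hle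
  have h2 := hanti (left_mem_Icc.2 (ht.1.trans ht.2)) ht ht.1
  simp only [zero_div, sub_zero] at h2
  exact norm_le_exp_neg_mul_of_weighted (by simpa [mul_assoc] using h2)

/-- **Uniqueness of the periodic solution**: two solutions on `[a,b]` (`a < b`) with the same forcing
and `x b = x a`, `y b = y a` coincide on `[a,b]` when `γ > 0`.
[cite: Fink1974, Thm 7.7 (uniqueness of the bounded solution)] [cite: Hale1980, Ch. IV §1 Thm 1.1] -/
theorem eqOn_of_periodic (hγ : 0 < γ) (hA : ∀ t x, ⟪A t x, x⟫_ℝ ≤ -γ * ‖x‖ ^ 2) {f x y : ℝ → E}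
    {a b : ℝ} (hab : a < b)
    (hxc : ContinuousOn x (Icc a b)) (hx : ∀ t ∈ Ioo a b, HasDerivAt x (A t (x t) + f t) t)
    (hyc : ContinuousOn y (Icc a b)) (hy : ∀ t ∈ Ioo a b, HasDerivAt y (A t (y t) + f t) t)
    (hxp : x b = x a) (hyp : y b = y a) : EqOn x y (Icc a b) := by
  have hb := norm_sub_le_exp_neg_mul hA hxc hx hyc hy (right_mem_Icc.2 hab.le)
  rw [hxp, hyp] at hb
  have hlt : Real.exp (-γ * (b - a)) < 1 := by
    have h := Real.exp_lt_exp.2 (show -γ * (b - a) < 0 by nlinarith)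
    rwa [Real.exp_zero] at h
  have h0 : ‖x a - y a‖ = 0 := by
    nlinarith [norm_nonneg (x a - y a), hb, hlt]
  have hxy : x a = y a := sub_eq_zero.1 (norm_eq_zero.1 h0)
  intro t ht
  have h := norm_sub_le_exp_neg_mul hA hxc hx hyc hy ht
  rw [hxy, sub_self, norm_zero, mul_zero] at h
  exact sub_eq_zero.1 (norm_eq_zero.1 (le_antisymm h (norm_nonneg _)))

/-! ## The `‖f‖/γ` bound -/

/-- The differential inequality behind the bound: `2⟪x, A x + f⟫ ≤ −γ‖x‖² + F²/γ` when
`⟪A x, x⟫ ≤ −γ‖x‖²`, `‖f‖ ≤ F`, `γ > 0`. [folklore] -/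
private theorem two_mul_inner_le (hγ : 0 < γ) (hA : ∀ t x, ⟪A t x, x⟫_ℝ ≤ -γ * ‖x‖ ^ 2) {F : ℝ}
    (t : ℝ) (x v : E) (hv : ‖v‖ ≤ F) :
    2 * ⟪x, A t x + v⟫_ℝ ≤ -γ * ‖x‖ ^ 2 + F ^ 2 / γ := by
  have h1 := hA t x
  rw [real_inner_comm] at h1
  have h2 : ⟪x, v⟫_ℝ ≤ ‖x‖ * F :=
    (real_inner_le_norm _ _).trans (mul_le_mul_of_nonneg_left hv (norm_nonneg _))
  rw [inner_add_right]
  -- AM–GM: `2‖x‖F ≤ γ‖x‖² + F²/γ`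
  set G : ℝ := F / γ with hG
  have hFG : F = γ * G := by rw [hG]; field_simp
  have h3 : F ^ 2 / γ = γ * G ^ 2 := by rw [hFG]; field_simp
  have h4 : 2 * (‖x‖ * F) ≤ γ * ‖x‖ ^ 2 + F ^ 2 / γ := by
    rw [h3, hFG]
    nlinarith [mul_nonneg hγ.le (sq_nonneg (‖x‖ - G))]
  linarith

/-- **The `‖f‖/γ` bound for the periodic solution.** If `⟪A t x, x⟫ ≤ −γ‖x‖²` (`γ > 0`),
`‖f t‖ ≤ F` on `(a,b)`, and `x` solves `x' = A x + f` on `(a,b)`, is continuous on `[a,b]` and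
satisfies `x b = x a` (`a < b`), then `‖x t‖ ≤ F/γ` for all `t ∈ [a,b]`: the quantity
`e^{γt}(‖x‖² − F²/γ²)` is non-increasing, and periodicity forces `‖x a‖² ≤ F²/γ²`.
[cite: Fink1974, Thm 7.7 (‖φ‖ ≤ (K₁/σ₁)‖f‖, stable case K₁ = 1, σ₁ = γ)] -/
theorem norm_le_div_of_periodic (hγ : 0 < γ) (hA : ∀ t x, ⟪A t x, x⟫_ℝ ≤ -γ * ‖x‖ ^ 2)
    {f x : ℝ → E} {a b F : ℝ} (hab : a < b) (hF : ∀ t ∈ Ioo a b, ‖f t‖ ≤ F)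
    (hxc : ContinuousOn x (Icc a b)) (hx : ∀ t ∈ Ioo a b, HasDerivAt x (A t (x t) + f t) t)
    (hper : x b = x a) : ∀ t ∈ Icc a b, ‖x t‖ ≤ F / γ := by
  have hF0 : 0 ≤ F := by
    have hm : (a + b) / 2 ∈ Ioo a b := ⟨by linarith, by linarith⟩
    exact (norm_nonneg _).trans (hF _ hm)
  have hle : ∀ s ∈ Ioo a b, 2 * ⟪x s, A s (x s) + f s⟫_ℝ ≤ -γ * ‖x s‖ ^ 2 + F ^ 2 / γ :=
    fun s hs => two_mul_inner_le hγ hA s (x s) (f s) (hF s hs)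
  have hanti := antitoneOn_exp_mul_norm_sq_sub hγ.ne' hxc hx hle
  have hC : F ^ 2 / γ / γ = (F / γ) ^ 2 := by field_simp
  -- periodic bootstrap at the left end
  have ha : ‖x a‖ ^ 2 ≤ (F / γ) ^ 2 := by
    by_contra hcon
    rw [not_le] at hcon
    have h := hanti (left_mem_Icc.2 hab.le) (right_mem_Icc.2 hab.le) hab.le
    simp only [hC, hper] at h
    have hpos : 0 < ‖x a‖ ^ 2 - (F / γ) ^ 2 := sub_pos.2 hcon
    have h' : Real.exp (γ * b) ≤ Real.exp (γ * a) := le_of_mul_le_mul_right h hpos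
    rw [Real.exp_le_exp] at h'
    nlinarith
  intro t ht
  have h := hanti (left_mem_Icc.2 hab.le) ht ht.1
  simp only [hC] at h
  have hza : Real.exp (γ * a) * (‖x a‖ ^ 2 - (F / γ) ^ 2) ≤ 0 :=
    mul_nonpos_iff.2 (Or.inl ⟨(Real.exp_pos _).le, sub_nonpos.2 ha⟩)
  have hzt : ‖x t‖ ^ 2 - (F / γ) ^ 2 ≤ 0 := by
    by_contra hcon
    rw [not_le] at hcon
    exact absurd (h.trans hza) (not_le.2 (mul_pos (Real.exp_pos _) hcon))
  exact (pow_le_pow_iff_left₀ (norm_nonneg _) (div_nonneg hF0 hγ.le) two_ne_zero).1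
    (sub_nonpos.1 hzt)

/-- **Absorbing ball (forward version).** Under the same hypotheses without periodicity: if
`‖x a‖ ≤ F/γ` then `‖x t‖ ≤ F/γ` on `[a,b]`. [cite: HairerNorsettWanner1993, §I.10 Thm 10.6 (10.22)] -/
theorem norm_le_div_of_norm_le_div (hγ : 0 < γ) (hA : ∀ t x, ⟪A t x, x⟫_ℝ ≤ -γ * ‖x‖ ^ 2)
    {f x : ℝ → E} {a b F : ℝ} (hF0 : 0 ≤ F) (hF : ∀ t ∈ Ioo a b, ‖f t‖ ≤ F)
    (hxc : ContinuousOn x (Icc a b)) (hx : ∀ t ∈ Ioo a b, HasDerivAt x (A t (x t) + f t) t)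
    (ha : ‖x a‖ ≤ F / γ) : ∀ t ∈ Icc a b, ‖x t‖ ≤ F / γ := by
  have hle : ∀ s ∈ Ioo a b, 2 * ⟪x s, A s (x s) + f s⟫_ℝ ≤ -γ * ‖x s‖ ^ 2 + F ^ 2 / γ :=
    fun s hs => two_mul_inner_le hγ hA s (x s) (f s) (hF s hs)
  have hanti := antitoneOn_exp_mul_norm_sq_sub hγ.ne' hxc hx hle
  have hC : F ^ 2 / γ / γ = (F / γ) ^ 2 := by field_simp
  have ha2 : ‖x a‖ ^ 2 ≤ (F / γ) ^ 2 := pow_le_pow_left₀ (norm_nonneg _) ha 2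
  intro t ht
  have h := hanti (left_mem_Icc.2 (ht.1.trans ht.2)) ht ht.1
  simp only [hC] at h
  have hza : Real.exp (γ * a) * (‖x a‖ ^ 2 - (F / γ) ^ 2) ≤ 0 :=
    mul_nonpos_iff.2 (Or.inl ⟨(Real.exp_pos _).le, sub_nonpos.2 ha2⟩)
  have hzt : ‖x t‖ ^ 2 - (F / γ) ^ 2 ≤ 0 := by
    by_contra hcon
    rw [not_le] at hcon
    exact absurd (h.trans hza) (not_le.2 (mul_pos (Real.exp_pos _) hcon))
  exact (pow_le_pow_iff_left₀ (norm_nonneg _) (div_nonneg hF0 hγ.le) two_ne_zero).1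
    (sub_nonpos.1 hzt)

/-! ## Free decay ("echo damping") -/

/-- **Free decay.** If the forcing vanishes on `(s,t)` then `‖x t‖ ≤ e^{−γ(t−s)}‖x s‖`
(`x` continuous on `[s,t]`, solving `x' = A x + f` on `(s,t)`).
[cite: HairerNorsettWanner1993, §I.10 Thm 10.6 (10.22) with δ = 0] -/
theorem norm_le_exp_neg_mul_of_forcing_eq_zero (hA : ∀ t x, ⟪A t x, x⟫_ℝ ≤ -γ * ‖x‖ ^ 2)
    {f x : ℝ → E} {s t : ℝ} (hst : s ≤ t)
    (hxc : ContinuousOn x (Icc s t)) (hx : ∀ τ ∈ Ioo s t, HasDerivAt x (A τ (x τ) + f τ) τ)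
    (hf0 : ∀ τ ∈ Ioo s t, f τ = 0) : ‖x t‖ ≤ Real.exp (-γ * (t - s)) * ‖x s‖ := by
  -- `x` and the zero function `0` both solve `u' = A u + f·𝟙` with the forcing `f = 0` on `(s,t)`:
  -- run the contraction against `y = 0`.
  have hx' : ∀ τ ∈ Ioo s t, HasDerivAt x (A τ (x τ) + (0 : E)) τ := fun τ hτ => by
    have h := hx τ hτ
    rwa [hf0 τ hτ] at h
  have hy' : ∀ τ ∈ Ioo s t, HasDerivAt (fun _ : ℝ => (0 : E)) (A τ ((fun _ : ℝ => (0 : E)) τ) + (0 : E)) τ :=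
    fun τ _ => by simpa using hasDerivAt_const τ (0 : E)
  have h := norm_sub_le_exp_neg_mul hA (f := fun _ => (0 : E)) hxc hx' continuousOn_const hy'
    (right_mem_Icc.2 hst)
  simpa using h

/-- **Free decay inside a larger solution interval**: `x` solves on `[a,b]`, the forcing vanishes on
`(s,t) ⊆ (a,b)`; then `‖x t‖ ≤ e^{−γ(t−s)}‖x s‖`. [cite: HairerNorsettWanner1993, §I.10 Thm 10.6 (10.22)] -/
theorem norm_le_exp_neg_mul_of_forcing_eq_zero_on (hA : ∀ t x, ⟪A t x, x⟫_ℝ ≤ -γ * ‖x‖ ^ 2)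
    {f x : ℝ → E} {a b s t : ℝ} (has : a ≤ s) (hst : s ≤ t) (htb : t ≤ b)
    (hxc : ContinuousOn x (Icc a b)) (hx : ∀ τ ∈ Ioo a b, HasDerivAt x (A τ (x τ) + f τ) τ)
    (hf0 : ∀ τ ∈ Ioo s t, f τ = 0) : ‖x t‖ ≤ Real.exp (-γ * (t - s)) * ‖x s‖ :=
  norm_le_exp_neg_mul_of_forcing_eq_zero hA hst (hxc.mono (Icc_subset_Icc has htb))
    (fun τ hτ => hx τ ⟨lt_of_le_of_lt has hτ.1, lt_of_lt_of_le hτ.2 htb⟩) hf0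

/-- **Echo damping for the periodic solution**: with `x b = x a`, `‖f‖ ≤ F` on `(a,b)` and `f = 0` on
`(s,t) ⊆ (a,b)`, `‖x t‖ ≤ e^{−γ(t−s)} · F/γ` — the response to forcing that stopped `t − s` ago.
[cite: Fink1974, Thm 7.7 (proof: φ(t) = ∫_{-∞}^t X(t)X⁻¹(s) f(s) ds, |X(t)X⁻¹(s)| ≤ K₁e^{-σ₁(t-s)})] -/
theorem norm_le_exp_neg_mul_div_of_periodic (hγ : 0 < γ) (hA : ∀ t x, ⟪A t x, x⟫_ℝ ≤ -γ * ‖x‖ ^ 2)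
    {f x : ℝ → E} {a b s t F : ℝ} (hab : a < b) (has : a ≤ s) (hst : s ≤ t) (htb : t ≤ b)
    (hF : ∀ τ ∈ Ioo a b, ‖f τ‖ ≤ F)
    (hxc : ContinuousOn x (Icc a b)) (hx : ∀ τ ∈ Ioo a b, HasDerivAt x (A τ (x τ) + f τ) τ)
    (hper : x b = x a) (hf0 : ∀ τ ∈ Ioo s t, f τ = 0) :
    ‖x t‖ ≤ Real.exp (-γ * (t - s)) * (F / γ) :=
  (norm_le_exp_neg_mul_of_forcing_eq_zero_on hA has hst htb hxc hx hf0).trans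
    (mul_le_mul_of_nonneg_left (norm_le_div_of_periodic hγ hA hab hF hxc hx hper s ⟨has, hst.trans htb⟩)
      (Real.exp_pos _).le)

end Dissipative

/-! ## The period-mean of an echo -/

/-- `∫_{t₁}^{t₂} e^{−γ(τ−s)} dτ = (e^{−γ(t₁−s)} − e^{−γ(t₂−s)})/γ ≤ e^{−γ(t₁−s)}/γ` (any `t₁, t₂`) — the
elementary integral in Fink's bound `∫_{-∞}^t K₁ e^{-σ₁(t-s)} ds = K₁/σ₁`. [cite: Fink1974, Thm 7.7 (proof)] -/
theorem intervalIntegral_exp_neg_mul_le {γ s t₁ t₂ : ℝ} (hγ : 0 < γ) :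
    ∫ τ in t₁..t₂, Real.exp (-γ * (τ - s)) ≤ Real.exp (-γ * (t₁ - s)) / γ := by
  have hderiv : ∀ τ ∈ uIcc t₁ t₂,
      HasDerivAt (fun τ => -Real.exp (-γ * (τ - s)) / γ) (Real.exp (-γ * (τ - s))) τ := by
    intro τ _
    have h1 : HasDerivAt (fun τ => -γ * (τ - s)) (-γ) τ := by
      simpa using ((hasDerivAt_id τ).sub_const s).const_mul (-γ)
    have h2 := (h1.exp.neg).div_const γ
    refine h2.congr_deriv ?_
    field_simp
  have hcont : Continuous fun τ => Real.exp (-γ * (τ - s)) :=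
    Real.continuous_exp.comp (continuous_const.mul (continuous_id.sub continuous_const))
  rw [integral_eq_sub_of_hasDerivAt hderiv (hcont.intervalIntegrable _ _)]
  have hpos : 0 < Real.exp (-γ * (t₂ - s)) / γ := div_pos (Real.exp_pos _) hγ
  have e : -Real.exp (-γ * (t₂ - s)) / γ - -Real.exp (-γ * (t₁ - s)) / γ =
      Real.exp (-γ * (t₁ - s)) / γ - Real.exp (-γ * (t₂ - s)) / γ := by ring
  rw [e]
  linarith

omit [InnerProductSpace ℝ E] in
/-- **Period-mean of an echo.** If `‖g τ‖ ≤ K‖x τ‖` and `‖x τ‖ ≤ e^{−γ(τ−s)} B` on `[t₁,t₂]`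
(`K, B ≥ 0`, `γ > 0`; no integrability hypothesis — a non-integrable `g` has integral `0`), then `‖∫_{t₁}^{t₂} g‖ ≤ K B e^{−γ(t₁−s)}/γ` — the
contribution of a decayed response to a windowed time average.
[cite: Fink1974, Thm 7.7 (proof: ‖φ‖ ≤ ∫ K₁e^{-σ₁(t-s)} ds ‖f‖)] -/
theorem norm_intervalIntegral_le_of_echo {V : Type*} [NormedAddCommGroup V] [NormedSpace ℝ V]
    {g : ℝ → V} {x : ℝ → E} {K B γ s t₁ t₂ : ℝ} (hγ : 0 < γ) (hK : 0 ≤ K) (hB : 0 ≤ B)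
    (ht : t₁ ≤ t₂) (hgK : ∀ τ ∈ Icc t₁ t₂, ‖g τ‖ ≤ K * ‖x τ‖)
    (hx : ∀ τ ∈ Icc t₁ t₂, ‖x τ‖ ≤ Real.exp (-γ * (τ - s)) * B) :
    ‖∫ τ in t₁..t₂, g τ‖ ≤ K * B * Real.exp (-γ * (t₁ - s)) / γ := by
  have hcont : Continuous fun τ => K * B * Real.exp (-γ * (τ - s)) :=
    continuous_const.mul (Real.continuous_exp.comp (continuous_const.mul (continuous_id.sub continuous_const)))
  have h1 : ‖∫ τ in t₁..t₂, g τ‖ ≤ ∫ τ in t₁..t₂, K * B * Real.exp (-γ * (τ - s)) := by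
    refine norm_integral_le_of_norm_le ht (ae_of_all _ fun τ hτ => ?_) (hcont.intervalIntegrable _ _)
    have hτ' : τ ∈ Icc t₁ t₂ := ⟨hτ.1.le, hτ.2⟩
    calc ‖g τ‖ ≤ K * ‖x τ‖ := hgK τ hτ'
      _ ≤ K * (Real.exp (-γ * (τ - s)) * B) := mul_le_mul_of_nonneg_left (hx τ hτ') hK
      _ = K * B * Real.exp (-γ * (τ - s)) := by ring
  refine h1.trans ?_
  rw [intervalIntegral.integral_const_mul, mul_div_assoc]
  exact mul_le_mul_of_nonneg_left (intervalIntegral_exp_neg_mul_le hγ) (mul_nonneg hK hB)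

end DissipativeResponse

end Literature.Analysis.ODE

end
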